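import Literature.AlgebraicGeometry.Motives.WeilDatumTransport
import Literature.AlgebraicGeometry.Motives.WeilHermitianLandherrUniqueness
import HarnessLib

/-!
# Transport of the Weil family along Landherr: every member of the component `(n, K, det H)` occurs in the family of any other (Deligne–Milne 1982, Prop. 4.1 and proof of Thm. 4.8; van Geemen 1994, 5.3–5.5)

Family `hodge`, layer `Literature/AlgebraicGeometry/Motives`; companion of `Motives/WeilDatumTransport`
(transport of Deligne's family `B → X⁺` along a `K`-linear `E`-isometry of Weil data; its §"hyperbolic"
supplies the isometry by Witt's theorem, for SPLIT data only) and of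
`Motives/WeilHermitianLandherrUniqueness` (Landherr: signature `(n, n)` and `det H` determine the
`K`-isometry class). Deligne (LNM 900, proof of Thm. 4.8, p. 47): a polarized abelian variety with
`E`-action "is a member of the family" as soon as there is an `E`-linear isomorphism `k₁ : H₁(A₁, ℚ) ≅ H`
carrying a Riemann form to `ψ`; van Geemen (LNM 1594, 5.3 and 5.5): the `n²`-dimensional family is built
from `(V, K, H)`, and by 5.4 with [L] = Landherr the isometry class of `H` of signature `(n, n)` is its
discriminant; E. Markman, arXiv:2502.03415 p. 3: "(n, K, det H) … determines [the component] up to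
isogenies".

## What is here (PROVED; no definition, no named fact)

* `exists_linearEquiv_weil_of_weilDiscriminant_eq_rat` — Landherr uniqueness in the rational dictionary
  (`[K : ℚ] = 2`, `dim_ℚ V = 4n`, signature data as `α`-stable `ℚ`-subspaces of `ℚ`-dimension `2n`), the
  format of the carriers' rational models (`Motives/HyperbolicWeilType`, `Motives/WeilOperatorModule`);
* **`WeilDatum.exists_hodgeStructure_eq_comapEquiv_of_weilDiscriminant_eq`** — for two alternating,
  non-degenerate Weil forms `E` on `U`, `E'` on `U'` over the same `K = ℚ(α)` (`α² = -d`), of the same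
  `K`-dimension `2n` (`n ≥ 1`), both of signature `(n, n)` and with EQUAL DISCRIMINANT, there is a
  `K`-linear `E`-isometry `g : U ≅ U'` (Landherr), and for every `J' ∈ X⁺(U', K, E')` the complex structure
  `g⁻¹ J' g ∈ X⁺(U, K, E)` carries the same polarized `ℚ`-Hodge structure along `g` — the datum
  `(U', E')` is, fibre by fibre, a member of the family of `(U, E)`. The hyperbolic case is
  `WeilDatum.exists_hodgeStructure_eq_comapEquiv_of_isotropic`.

## References

* [Deligne1982HodgeCycles] P. Deligne, LNM 900 (1982), §4 Prop. 4.1 and proof of Thm. 4.8 (pp. 47–50).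
* [vanGeemen1994HodgeAV] B. van Geemen, LNM 1594 (1994), Lemma 5.2, 5.3–5.5 and (5.4.1).
* [Landherr1936HermitianForms] W. Landherr, Abh. Math. Sem. Hamburg 11 (1936) 245–248.
-/

noncomputable section

open Module

namespace Literature.AlgebraicGeometry.Motives


/-! ### Landherr uniqueness in the rational dictionary (`α`-stable `ℚ`-subspaces) -/

section Rat

variable {K : Type*} [Field K] [Algebra ℚ K] {V V' : Type} [AddCommGroup V] [Module ℚ V] [Module K V]
  [IsScalarTower ℚ K V] [Module.Finite K V] [AddCommGroup V'] [Module ℚ V'] [Module K V']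
  [IsScalarTower ℚ K V'] [Module.Finite K V']

/-- **Landherr uniqueness in van Geemen's rational dictionary** (the format of `Motives/HyperbolicWeilType` and of
the carriers' rational models: `[K : ℚ] = 2`, `dim_ℚ V = 4n`, signature `(n, n)` given by `α`-STABLE
`ℚ`-subspaces `P`, `N` of `ℚ`-dimension `2n`, positive resp. negative for `x ↦ E(x, αx)`, `P ⊓ N = 0`): two
alternating Weil forms with such data and equal discriminant are `K`-isometric (an `α`-stable `ℚ`-subspace is a
`K`-subspace of half the dimension, `exists_submodule_of_smul_mem`; then
`exists_linearEquiv_weil_of_weilDiscriminant_eq`). [cite: Landherr1936HermitianForms]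
[cite: vanGeemen1994HodgeAV, Lemma 5.2 (2)–(4), 5.4 and (5.4.1)] [cite: Deligne1982HodgeCycles, §4 Prop. 4.1] -/
theorem exists_linearEquiv_weil_of_weilDiscriminant_eq_rat (E : LinearMap.BilinForm ℚ V)
    (E' : LinearMap.BilinForm ℚ V') {α : K} {d : ℚ} (σ : K →+* K) (hd : 0 < d)
    (hα : α * α = algebraMap ℚ K (-d)) (hσα : σ α = -α)
    (hK : ∀ k : K, ∃ a b : ℚ, k = algebraMap ℚ K a + algebraMap ℚ K b * α) (hK2 : finrank ℚ K = 2)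
    (hσ : ∀ k : K, k * σ k = algebraMap ℚ K (Algebra.norm ℚ k))
    (hE : ∀ x y : V, E x y = -E y x) (hW : ∀ x y : V, E (α • x) (α • y) = d * E x y)
    (hE' : ∀ x y : V', E' x y = -E' y x) (hW' : ∀ x y : V', E' (α • x) (α • y) = d * E' x y)
    {n : ℕ} (hn : 1 ≤ n)
    (hV : finrank ℚ V = 4 * n) (P N : Submodule ℚ V) (hPα : ∀ x ∈ P, α • x ∈ P) (hNα : ∀ x ∈ N, α • x ∈ N)
    (hPn : finrank ℚ P = 2 * n) (hNn : finrank ℚ N = 2 * n) (hPN : P ⊓ N = ⊥)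
    (hP : ∀ x ∈ P, x ≠ 0 → 0 < E x (α • x)) (hNeg : ∀ x ∈ N, x ≠ 0 → E x (α • x) < 0)
    (hV' : finrank ℚ V' = 4 * n) (P' N' : Submodule ℚ V') (hPα' : ∀ x ∈ P', α • x ∈ P')
    (hNα' : ∀ x ∈ N', α • x ∈ N') (hPn' : finrank ℚ P' = 2 * n) (hNn' : finrank ℚ N' = 2 * n)
    (hPN' : P' ⊓ N' = ⊥) (hP' : ∀ x ∈ P', x ≠ 0 → 0 < E' x (α • x))
    (hNeg' : ∀ x ∈ N', x ≠ 0 → E' x (α • x) < 0)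
    (hdisc : weilDiscriminant E α = weilDiscriminant E' α) :
    ∃ g : V ≃ₗ[K] V', ∀ x y, E' (g x) (g y) = E x y := by
  have hVK : finrank K V = 2 * n := by
    have h := Module.finrank_mul_finrank ℚ K V
    rw [hK2, hV] at h
    omega
  have hVK' : finrank K V' = 2 * n := by
    have h := Module.finrank_mul_finrank ℚ K V'
    rw [hK2, hV'] at h
    omega
  obtain ⟨SP, hSP, hSPn⟩ := exists_submodule_of_smul_mem hK hK2 P hPα hPn
  obtain ⟨SN, hSN, hSNn⟩ := exists_submodule_of_smul_mem hK hK2 N hNα hNn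
  obtain ⟨SP', hSP', hSPn'⟩ := exists_submodule_of_smul_mem hK hK2 P' hPα' hPn'
  obtain ⟨SN', hSN', hSNn'⟩ := exists_submodule_of_smul_mem hK hK2 N' hNα' hNn'
  have hinf : SP ⊓ SN = ⊥ := by
    rw [Submodule.eq_bot_iff]
    intro x hx
    have h : x ∈ P ⊓ N := ⟨(hSP x).1 hx.1, (hSN x).1 hx.2⟩
    rwa [hPN, Submodule.mem_bot] at h
  have hinf' : SP' ⊓ SN' = ⊥ := by
    rw [Submodule.eq_bot_iff]
    intro x hx
    have h : x ∈ P' ⊓ N' := ⟨(hSP' x).1 hx.1, (hSN' x).1 hx.2⟩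
    rwa [hPN', Submodule.mem_bot] at h
  exact exists_linearEquiv_weil_of_weilDiscriminant_eq σ hd hα hσα hK hσ n hn V V' hVK hVK' E E' hE hW
    ⟨SP, SN, hSPn, hSNn, hinf, fun x hx hx0 => hP x ((hSP x).1 hx) hx0,
      fun x hx hx0 => hNeg x ((hSN x).1 hx) hx0⟩
    hE' hW' ⟨SP', SN', hSPn', hSNn', hinf', fun x hx hx0 => hP' x ((hSP' x).1 hx) hx0,
      fun x hx hx0 => hNeg' x ((hSN' x).1 hx) hx0⟩ hdisc

end Rat

namespace WeilDatum

variable {K : Type*} [Field K] [Algebra ℚ K] {U U' : Type} [AddCommGroup U] [Module ℚ U] [Module K U]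
  [IsScalarTower ℚ K U] [AddCommGroup U'] [Module ℚ U'] [Module K U'] [IsScalarTower ℚ K U']
  [Module.Finite K U] [Module.Finite K U']

/-- **Landherr ⟹ every member of the component `(n, K, det H)` is, fibre by fibre, isomorphic to the
family of any other** (Deligne (c), p. 47–48; van Geemen 5.3–5.5 with [L]): for `(U, K, E)`, `(U', K, E')`
alternating non-degenerate of Weil type, `dim_K = 2n`, `n ≥ 1`, both of signature `(n, n)` (definite
`K`-subspaces of dimension `n` meeting in `0`) and `det H_E = det H_{E'}` in `ℚˣ ⧸ Nm(Kˣ)`: a `K`-linear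
`E`-isometry `g : U ≅ U'` (`Motives.exists_linearEquiv_weil_of_weilDiscriminant_eq`) and, for every
`J' ∈ X⁺(U', K, E')`, a `J ∈ X⁺(U, K, E)` with the same polarized Hodge structure along `g`.
[cite: Deligne1982HodgeCycles, §4 Prop. 4.1 and proof of Thm. 4.8 (pp. 47–48)]
[cite: vanGeemen1994HodgeAV, 5.3–5.5 and (5.4.1)] [cite: Landherr1936HermitianForms] -/
theorem exists_hodgeStructure_eq_comapEquiv_of_weilDiscriminant_eq (E : LinearMap.BilinForm ℚ U)
    (E' : LinearMap.BilinForm ℚ U') {α : K} {d : ℚ} (σ : K →+* K) (hd : 0 < d)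
    (hα : α * α = algebraMap ℚ K (-d)) (hσα : σ α = -α)
    (hK : ∀ k : K, ∃ a b : ℚ, k = algebraMap ℚ K a + algebraMap ℚ K b * α)
    (hσ : ∀ k : K, k * σ k = algebraMap ℚ K (Algebra.norm ℚ k))
    (hE : ∀ x y : U, E y x = -E x y) (hW : ∀ x y : U, E (α • x) (α • y) = d * E x y) (hN : E.Nondegenerate)
    (hE' : ∀ x y : U', E' y x = -E' x y) (hW' : ∀ x y : U', E' (α • x) (α • y) = d * E' x y)
    (hN' : E'.Nondegenerate) {n : ℕ} (hn : 1 ≤ n)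
    (hU : finrank K U = 2 * n)
    (hPN : ∃ P N : Submodule K U, finrank K P = n ∧ finrank K N = n ∧ P ⊓ N = ⊥ ∧
      (∀ x ∈ P, x ≠ 0 → 0 < E x (α • x)) ∧ (∀ x ∈ N, x ≠ 0 → E x (α • x) < 0))
    (hU' : finrank K U' = 2 * n)
    (hPN' : ∃ P' N' : Submodule K U', finrank K P' = n ∧ finrank K N' = n ∧ P' ⊓ N' = ⊥ ∧
      (∀ x ∈ P', x ≠ 0 → 0 < E' x (α • x)) ∧ (∀ x ∈ N', x ≠ 0 → E' x (α • x) < 0))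
    (hdisc : weilDiscriminant E α = weilDiscriminant E' α) :
    ∃ g : U ≃ₗ[ℚ] U', (∀ u, g (α • u) = α • g u) ∧ (∀ x y, E' (g x) (g y) = E x y) ∧
      ∀ (J' : (ofSMul E' hd hα hE' hW' hN').Cx →ₗ[ℂ] (ofSMul E' hd hα hE' hW' hN').Cx)
        (hWJ' : IsWeilComplexStructure (ofSMul E' hd hα hE' hW' hN').hForm J'),
        ∃ (J : (ofSMul E hd hα hE hW hN).Cx →ₗ[ℂ] (ofSMul E hd hα hE hW hN).Cx)
          (hWJ : IsWeilComplexStructure (ofSMul E hd hα hE hW hN).hForm J),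
          (ofSMul E hd hα hE hW hN).hodgeStructure J hWJ.sq =
              ((ofSMul E' hd hα hE' hW' hN').hodgeStructure J' hWJ'.sq).comapEquiv g ∧
            ∀ x y, ((ofSMul E' hd hα hE' hW' hN').polarization J' hWJ').form (g x) (g y) =
              ((ofSMul E hd hα hE hW hN).polarization J hWJ).form x y := by
  obtain ⟨g₀, hg₀⟩ := exists_linearEquiv_weil_of_weilDiscriminant_eq σ hd hα hσα hK hσ n hn U U' hU hU'
    E E' (fun x y => hE y x) hW hPN (fun x y => hE' y x) hW' hPN' hdisc
  set g : U ≃ₗ[ℚ] U' := g₀.restrictScalars ℚ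
  have hgα : ∀ u, g (α • u) = α • g u := fun u => g₀.map_smul α u
  have hgE : ∀ x y, E' (g x) (g y) = E x y := hg₀
  refine ⟨g, hgα, hgE, fun J' hWJ' => ?_⟩
  exact (ofSMul E hd hα hE hW hN).exists_hodgeStructure_eq_comapEquiv (ofSMul E' hd hα hE' hW' hN') g rfl
    (fun u => by rw [ofSMul_α_apply, ofSMul_α_apply, hgα]) hgE hWJ'

end WeilDatum

end Literature.AlgebraicGeometry.Motives

end
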